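import Mathlib
import HarnessLib
import Literature.MathematicalPhysics.StatisticalMechanics.RenormalisationMap
import Literature.Probability.Distributions.GaussianLinearCompensation
import Summits.HubbardSuperconductivity.HubbardSuperconductivity.Theorems.ComplexGFFStiffnessDefs
import Summits.HubbardSuperconductivity.HubbardSuperconductivity.Theorems.ComplexGFFStiffnessHypACumulantIota
import Summits.HubbardSuperconductivity.HubbardSuperconductivity.Theorems.ComplexGFFStiffnessHypACumulantIotaHamiltonian

/-!
# Crux `HypACumulant`, line `gnv` — the renormalisation transformation `T_k` is `ι`-equivariant

Route `route-HubbardSuperconductivity-ComplexGFFStiffness`, crux item stmt-HubbardSuperconductivity-19154,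
research stub `stub_gnvOfFrd : TorusFRD 4 → GNV`.  The crux's stated risk ("why it might fail") is
that some step of the printed renormalisation group of Adams–Buchholz–Kotecký–Müller, run on the
COMPLEX perturbation, is not equivariant under the reflection `ι : F ↦ (φ ↦ conj F(−φ))`, so that
the fine-tuned quadratic form could become complex.  This file proves that the concrete
renormalisation transformation `T_k = rgStep` of the tree
(`Literature/…/RenormalisationMap.lean`, [ABKM19] Definition 6.5) IS `ι`-equivariant:

* (vocabulary from `Theorems/ComplexGFFStiffnessDefs.lean`:) `IsIotaHam H` — real constant and
  quadratic, imaginary linear coefficients (`H(B, −φ) = conj H(B, φ)`); `IsIotaFun K` —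
  `K(X, −φ) = conj K(X, φ)`;
* `isNegInvariant_stepMeasure` — the fluctuation measure `N(0, circulant 𝒞)` is invariant under
  `ξ ↦ −ξ`; `iota_fluct` — `R_{k+1}` preserves `ι`-symmetry;
* `iota_fderiv_zero`, **`isIotaHam_Pi2`** — `Π₂` of an `ι`-symmetric `C²` functional is an
  `ι`-Hamiltonian (constant and quadratic Taylor coefficients real, linear ones imaginary);
* `iota_bprod`, `iota_pcirc`, `iota_midK`, **`iota_nextK`** — the reblocked perturbation (6.34) is
  `ι`-symmetric when `I, Ĩ, K` are and the fluctuation measure is reflection invariant;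
* **`isIotaHam_nextH`**, **`isIotaFun_nextKStep`** — `T_k(H, K) = (H_{k+1}, K_{k+1})` maps
  `ι`-Hamiltonians and `ι`-functionals to such (given `C²`-regularity of `R_{k+1}H(B₀)` and
  `R_{k+1}K(B₀)` at the reference block, the input `Π₂` needs).

Consequently every relevant Hamiltonian produced along the flow started from the model's
`ι`-symmetric activity (`iota_pertK`) has a REAL quadratic part — the form that Ch. 12 fine-tunes.
All proved; no `sorry`; the two regularity hypotheses are explicit.

## References
* S. Adams, S. Buchholz, R. Kotecký, S. Müller, arXiv:1910.13564, Definition 6.5, Lemma 8.5 /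
  Definition 8.6 (`Π₂`), Ch. 12 (fine tuning of the quadratic form) [AdamsBuchholzKoteckyMuller2019].
-/

noncomputable section

-- `Summit.<Summit>.<Problem>`: single-conjunct summit, the duplicate component is mandated (D-0017).
set_option linter.dupNamespace false

namespace Summit.HubbardSuperconductivity.HubbardSuperconductivity.Theorems.ComplexGFF

open scoped BigOperators ComplexConjugate Classical
open MeasureTheory Finset
open Literature.MathematicalPhysics.StatisticalMechanics.GradientRG
open Literature.MathematicalPhysics.StatisticalMechanics.TorusPolymer (polys blocks bprod pcirc reblock)
open Literature.Probability.Distributions (matrixCLM multivariateGaussian_map_matrix ofLp_matrixCLM)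

variable {d M : ℕ} [NeZero M]

/-! ## `ι`-symmetric Hamiltonians and functionals -/

/-- `ι`-Hamiltonians are closed under subtraction. -/
theorem IsIotaHam.sub {H H' : RelevantHamiltonian ℂ d} (hH : IsIotaHam H) (hH' : IsIotaHam H') :
    IsIotaHam (H - H') := by
  refine ⟨fun u => ?_, fun α => ?_, fun q => ?_⟩
  · simp only [Pi.sub_apply, map_sub, hH.1, hH'.1]
  · simp only [Pi.sub_apply, map_sub, hH.2.1, hH'.2.1]; ring
  · simp only [Pi.sub_apply, map_sub, hH.2.2, hH'.2.2]

omit [NeZero M] in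
/-- `H(B, −φ) = conj H(B, φ)` for an `ι`-Hamiltonian. -/
theorem IsIotaHam.eval_neg {H : RelevantHamiltonian ℂ d} (hH : IsIotaHam H)
    (B : Finset (Fin d → ZMod M)) (φ : (Fin d → ZMod M) → ℝ) : eval H B (-φ) = conj (eval H B φ) :=
  eval_neg_eq_conj hH.1 hH.2.1 hH.2.2 B φ

omit [NeZero M] in
/-- `e^{−H(B,·)}` is `ι`-symmetric for an `ι`-Hamiltonian. -/
theorem IsIotaHam.isIotaFun_expNegH {H : RelevantHamiltonian ℂ d} (hH : IsIotaHam H) :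
    IsIotaFun (expNegH (M := M) H) := fun B φ => by
  unfold expNegH
  rw [hH.eval_neg, ← map_neg, Complex.exp_conj]

/-! ## The fluctuation measure is reflection invariant; `R_{k+1}` is `ι`-equivariant -/

/-- **`N(0, circulant 𝒞)` is invariant under `ξ ↦ −ξ`** (`circulant 𝒞 ⪰ 0`). -/
theorem isNegInvariant_stepMeasure {𝒞 : (Fin d → ZMod M) → ℝ} (hC : (Matrix.circulant 𝒞).PosSemidef) :
    (stepMeasure 𝒞).IsNegInvariant := by
  refine ⟨?_⟩
  have hcomp : (Neg.neg : ((Fin d → ZMod M) → ℝ) → _) ∘ (WithLp.ofLp : EuclideanSpace ℝ (Fin d → ZMod M) → _) =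
      WithLp.ofLp ∘ matrixCLM (-1 : Matrix (Fin d → ZMod M) (Fin d → ZMod M) ℝ) := by
    funext ψ
    simp only [Function.comp_apply, ofLp_matrixCLM, Matrix.neg_mulVec, Matrix.one_mulVec]
  rw [Measure.neg, stepMeasure, Measure.map_map measurable_neg (PiLp.continuous_ofLp 2 _).measurable, hcomp,
    ← Measure.map_map (PiLp.continuous_ofLp 2 _).measurable (matrixCLM (-1 : Matrix _ _ ℝ)).continuous.measurable,
    multivariateGaussian_map_matrix hC]
  simp

/-- **`R_{k+1}` is `ι`-equivariant**: `(R F)(−φ) = conj (R F)(φ)` for `ι`-symmetric `F`. -/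
theorem iota_fluct {𝒞 : (Fin d → ZMod M) → ℝ} (hC : (Matrix.circulant 𝒞).PosSemidef)
    {F : ((Fin d → ZMod M) → ℝ) → ℂ} (hF : ∀ φ, F (-φ) = conj (F φ)) (φ : (Fin d → ZMod M) → ℝ) :
    fluct 𝒞 F (-φ) = conj (fluct 𝒞 F φ) := by
  haveI := isNegInvariant_stepMeasure hC
  exact iota_integral_add (stepMeasure 𝒞) hF φ

/-! ## `Π₂` of an `ι`-symmetric functional is an `ι`-Hamiltonian -/

/-- The first derivative at `0` of an `ι`-symmetric `C¹` functional is purely imaginary. -/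
theorem iota_fderiv_zero {F : ((Fin d → ZMod M) → ℝ) → ℂ} (hFd : ContDiff ℝ 1 F)
    (hF : ∀ φ, F (-φ) = conj (F φ)) (v : (Fin d → ZMod M) → ℝ) :
    conj (fderiv ℝ F 0 v) = -fderiv ℝ F 0 v := by
  have h := iota_iteratedFDeriv_zero_odd hFd hF odd_one (fun _ : Fin 1 => v)
  rwa [iteratedFDeriv_one_apply] at h

/-- **`Π₂ F` is an `ι`-Hamiltonian for `ι`-symmetric `C²` functionals `F`** (Lemma 8.5: the
coefficients are real multiples of `F(0)` (real), of `DF(0)(b_α)` (imaginary), of `D²F(0)(b_i,b_j)`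
(real)). -/
theorem isIotaHam_Pi2 {F : ((Fin d → ZMod M) → ℝ) → ℂ} (hFd : ContDiff ℝ 2 F)
    (hF : ∀ φ, F (-φ) = conj (F φ)) (c : Fin d → ZMod M) (B : Finset (Fin d → ZMod M)) :
    IsIotaHam (Pi2 c B F) := by
  have h1 : ∀ v, conj (fderiv ℝ F 0 v) = -fderiv ℝ F 0 v :=
    iota_fderiv_zero (hFd.of_le (by norm_num)) hF
  have h2 : ∀ m : Fin 2 → (Fin d → ZMod M) → ℝ, conj (iteratedFDeriv ℝ 2 F 0 m) = iteratedFDeriv ℝ 2 F 0 m :=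
    iota_iteratedFDeriv_zero_even hFd hF even_two
  refine ⟨fun u => ?_, fun α => ?_, fun q => ?_⟩
  · simp only [Pi2, Pi2Data_const, Complex.real_smul, map_mul, Complex.conj_ofReal, iota_apply_zero_real hF]
  · simp only [Pi2, Pi2Data_lin, map_sum, Complex.real_smul, map_mul, Complex.conj_ofReal, h1, mul_neg,
      Finset.sum_neg_distrib]
  · simp only [Pi2, Pi2Data_quad, Complex.real_smul, map_mul, Complex.conj_ofReal, h2]

/-! ## The pieces of (6.34) are `ι`-symmetric -/

/-- Block products of `ι`-symmetric one-block functionals are `ι`-symmetric. -/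
theorem iota_bprod {s : ℕ} {F : Finset (Fin d → ZMod M) → ((Fin d → ZMod M) → ℝ) → ℂ} (hF : IsIotaFun F)
    (X : Finset (Fin d → ZMod M)) (φ : (Fin d → ZMod M) → ℝ) :
    bprod s (fun B => F B (-φ)) X = conj (bprod s (fun B => F B φ) X) := by
  unfold bprod
  rw [map_prod]
  exact Finset.prod_congr rfl fun B _ => hF B φ

/-- Circle products of `ι`-symmetric functionals are `ι`-symmetric. -/
theorem iota_pcirc {s : ℕ} {F G : Finset (Fin d → ZMod M) → ((Fin d → ZMod M) → ℝ) → ℂ}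
    (hF : IsIotaFun F) (hG : IsIotaFun G) (X : Finset (Fin d → ZMod M)) (φ : (Fin d → ZMod M) → ℝ) :
    pcirc s (fun Y => F Y (-φ)) (fun Y => G Y (-φ)) X = conj (pcirc s (fun Y => F Y φ) (fun Y => G Y φ) X) := by
  unfold pcirc
  rw [map_sum]
  exact Finset.sum_congr rfl fun Y _ => by simp only [map_mul, hF Y φ, hG (X \ Y) φ]

/-- **`Φ(X, −φ, −ξ) = conj Φ(X, φ, ξ)`** for `ι`-symmetric `I, Ĩ, K`. -/
theorem iota_midK {s : ℕ} {I It K : Finset (Fin d → ZMod M) → ((Fin d → ZMod M) → ℝ) → ℂ}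
    (hI : IsIotaFun I) (hIt : IsIotaFun It) (hK : IsIotaFun K) (X : Finset (Fin d → ZMod M))
    (φ ξ : (Fin d → ZMod M) → ℝ) :
    midK s I It K X (-φ) (-ξ) = conj (midK s I It K X φ ξ) := by
  have h1 : IsIotaFun (fun (B : Finset (Fin d → ZMod M)) (ψ : (Fin d → ZMod M) → ℝ) => 1 - It B ψ) :=
    fun B ψ => by simp only [hIt B ψ, map_sub, map_one]
  have hI1 : IsIotaFun (fun (B : Finset (Fin d → ZMod M)) (ψ : (Fin d → ZMod M) → ℝ) => I B ψ - 1) :=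
    fun B ψ => by simp only [hI B ψ, map_sub, map_one]
  have hneg : -φ + -ξ = -(φ + ξ) := by abel
  unfold midK
  rw [hneg]
  unfold pcirc
  rw [map_sum]
  refine Finset.sum_congr rfl fun Y _ => ?_
  rw [map_mul, map_sum]
  congr 1
  · simpa using iota_bprod (s := s) h1 Y φ
  · refine Finset.sum_congr rfl fun Z _ => ?_
    rw [map_mul]
    congr 1
    · simpa using iota_bprod (s := s) hI1 Z (φ + ξ)
    · exact hK _ _

/-- **`K_{k+1}` of (6.34) is `ι`-symmetric** when `I, Ĩ, K` are and the fluctuation measure is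
reflection invariant (any reblocking map). -/
theorem iota_nextK {s : ℕ} (π : Finset (Fin d → ZMod M) → Finset (Fin d → ZMod M))
    (μ : Measure ((Fin d → ZMod M) → ℝ)) [μ.IsNegInvariant]
    {I It K : Finset (Fin d → ZMod M) → ((Fin d → ZMod M) → ℝ) → ℂ}
    (hI : IsIotaFun I) (hIt : IsIotaFun It) (hK : IsIotaFun K) :
    IsIotaFun (nextK s π μ I It K) := by
  intro U φ
  unfold nextK
  rw [map_sum]
  refine Finset.sum_congr rfl fun X _ => ?_
  rw [map_mul, map_mul, map_inv₀, iota_bprod hIt, iota_bprod hIt, ← integral_conj,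
    ← integral_neg_eq_self (fun ξ => midK s I It K X (-φ) ξ) μ]
  congr 1
  exact integral_congr_ae (Filter.Eventually.of_forall fun ξ => iota_midK hI hIt hK X φ ξ)

/-! ## `T_k` is `ι`-equivariant -/

/-- **`H_{k+1}` is an `ι`-Hamiltonian** when `H_k` is, `K_k` is `ι`-symmetric, the fluctuation
covariance is positive semidefinite, and `R_{k+1}H_k(B₀)`, `R_{k+1}K_k(B₀)` are `C²` (the regularity
`Π₂` requires). -/
theorem isIotaHam_nextH (D : StepData d M) (hC : (Matrix.circulant D.𝒞).PosSemidef)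
    {H : RelevantHamiltonian ℂ d} (hH : IsIotaHam H)
    {K : Finset (Fin d → ZMod M) → ((Fin d → ZMod M) → ℝ) → ℂ} (hK : IsIotaFun K)
    (hH2 : ContDiff ℝ 2 (fluct D.𝒞 (eval H D.B₀))) (hK2 : ContDiff ℝ 2 (fluct D.𝒞 (K D.B₀))) :
    IsIotaHam (nextH D H K) := by
  unfold nextH
  exact (isIotaHam_Pi2 hH2 (iota_fluct hC (fun φ => hH.eval_neg D.B₀ φ)) D.c₀ D.B₀).sub
    (isIotaHam_Pi2 hK2 (iota_fluct hC (fun φ => hK D.B₀ φ)) D.c₀ D.B₀)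

/-- **`K_{k+1}` is `ι`-symmetric** under the same hypotheses: the renormalisation transformation
`T_k` preserves the `ι`-symmetric class, so the quadratic part of every Hamiltonian along the flow
stays real. -/
theorem isIotaFun_nextKStep (D : StepData d M) (hC : (Matrix.circulant D.𝒞).PosSemidef)
    {H : RelevantHamiltonian ℂ d} (hH : IsIotaHam H)
    {K : Finset (Fin d → ZMod M) → ((Fin d → ZMod M) → ℝ) → ℂ} (hK : IsIotaFun K)
    (hH2 : ContDiff ℝ 2 (fluct D.𝒞 (eval H D.B₀))) (hK2 : ContDiff ℝ 2 (fluct D.𝒞 (K D.B₀))) :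
    IsIotaFun (nextKStep D H K) := by
  haveI := isNegInvariant_stepMeasure hC
  unfold nextKStep
  exact iota_nextK _ _ hH.isIotaFun_expNegH (isIotaHam_nextH D hC hH hK hH2 hK2).isIotaFun_expNegH hK

/-- **`T_k` is `ι`-equivariant** (both components). -/
theorem iota_rgStep (D : StepData d M) (hC : (Matrix.circulant D.𝒞).PosSemidef)
    {H : RelevantHamiltonian ℂ d} (hH : IsIotaHam H)
    {K : Finset (Fin d → ZMod M) → ((Fin d → ZMod M) → ℝ) → ℂ} (hK : IsIotaFun K)
    (hH2 : ContDiff ℝ 2 (fluct D.𝒞 (eval H D.B₀))) (hK2 : ContDiff ℝ 2 (fluct D.𝒞 (K D.B₀))) :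
    IsIotaHam (rgStep D (H, K)).1 ∧ IsIotaFun (rgStep D (H, K)).2 :=
  ⟨isIotaHam_nextH D hC hH hK hH2 hK2, isIotaFun_nextKStep D hC hH hK hH2 hK2⟩

end Summit.HubbardSuperconductivity.HubbardSuperconductivity.Theorems.ComplexGFF

end
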